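import Mathlib
import Summits.HodgeConjecture.HodgeConjecture.Theses.CurveNetMordellWeil

/-!
# Crux `VerticalSupportBelowMiddle` (stmt-HodgeConjecture-2783), line `Sketch` — stub `stub_vsbm_middle`

The MIDDLE degree from crux #2 (pure logic; the `n = 2q` branch of the route's deciding theorem
`closes`): granted `ComplexOrientationExists`, `CurveNetExists`, `DeligneDescent`,
`GysinPreservesAlgebraic` and `VerticalSupportMiddle`, and the Hodge conjecture in all codimensions
`d < q` (all dimensions), every rational `(q,q)`-class on a smooth projective `2q`-fold `X` is
algebraic: take the curve net `(X', σ, pr)` of `X` (`CurveNetExists`), split a Hodge class on `X'`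
into algebraic + vertical (`VerticalSupportMiddle`), send the vertical part through
`DeligneDescent` to Gysin images of Hodge classes of codimension `d < q`, which are algebraic by
hypothesis and stay algebraic under Gysin maps (`GysinPreservesAlgebraic`, `d + e = q`), and push
down to `X` by `σ_*` (`GysinPreservesAlgebraic`, `e = 0`).
-/

noncomputable section

-- mandated namespace `Summit.HodgeConjecture.HodgeConjecture.Theorems` (single-problem summit: Problem =
-- Summit) trips `linter.dupNamespace`; off tree-wide in the lakefile, restated for stand-alone elaboration.
set_option linter.dupNamespace false

namespace Summit.HodgeConjecture.HodgeConjecture.Theorems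

open Literature.AlgebraicGeometry Literature.AlgebraicGeometry.Motives
  Literature.AlgebraicGeometry.HodgeTheory
open Summit.HodgeConjecture.HodgeConjecture.Theses.CurveNetMordellWeil

/-- **Stub `stub_vsbm_middle` of line `Sketch` (crux `VerticalSupportBelowMiddle`)**: the route
items `ComplexOrientationExists`, `CurveNetExists`, `DeligneDescent`, `GysinPreservesAlgebraic`,
`VerticalSupportMiddle` and the Hodge conjecture in all codimensions `d < q` give the Hodge
conjecture in codimension `q` on every smooth projective `2q`-fold (`q ≥ 2`): curve net on a
blow-up, crux #2, Deligne descent of the vertical part, induction hypothesis, push-down — verbatim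
the middle branch of the route's deciding theorem `closes`. -/
theorem stub_vsbm_middle :
    ComplexOrientationExists → CurveNetExists → DeligneDescent → GysinPreservesAlgebraic →
    VerticalSupportMiddle →
    ∀ ⦃q : ℕ⦄, 2 ≤ q →
      (∀ d : ℕ, d < q → ∀ ⦃m : ℕ⦄ ⦃W : SchemeOver ℂ⦄, IsSmoothProjective m W →
        Submodule.span ℂ {c : complexBetti W (2 * d) |
          IsRationalClass c ∧ IsOfHodgeType m W (2 * d) d d c} ≤ algebraicClasses W d) →
      ∀ ⦃X : SchemeOver ℂ⦄, IsSmoothProjective (2 * q) X →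
        Submodule.span ℂ {c : complexBetti X (2 * q) |
          IsRationalClass c ∧ IsOfHodgeType (2 * q) X (2 * q) q q c} ≤ algebraicClasses X q := by
  intro hOr hNet hDesc hGys hMid q hq ih X hX
  obtain ⟨μ, hμ⟩ := hOr
  obtain ⟨X', hX', σ, pr, hsurj, hle⟩ :=
    hNet μ hμ hX (show 2 ≤ 2 * q by omega) (show 2 * q - 1 + 1 = 2 * q by omega)
  -- vertical Hodge classes on the total space of the curve net are algebraic (descent + hypothesis)
  have vert : ∀ c : complexBetti X' (2 * q), IsRationalClass c →
      IsOfHodgeType (2 * q) X' (2 * q) q q c →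
      ∀ T : Set (projectiveSpace (2 * q - 1) ℂ).left, IsClosed T → T ≠ Set.univ →
      complexBetti.restrictCompl X' (pr.left.base ⁻¹' T) (2 * q) c = 0 →
      c ∈ algebraicClasses X' q := by
    intro c hc hh T hT hTne hcT
    have hY : IsClosed (pr.left.base ⁻¹' T) := hT.preimage pr.left.base.hom.continuous
    have hYne : pr.left.base ⁻¹' T ≠ Set.univ := by
      intro hU
      apply hTne
      refine Set.eq_univ_of_forall fun t => ?_
      obtain ⟨x, rfl⟩ := hsurj t
      have hx : x ∈ pr.left.base ⁻¹' T := by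
        rw [hU]
        exact Set.mem_univ x
      exact hx
    have hmem := hDesc μ hμ hX' (pr.left.base ⁻¹' T) hY hYne c hc hh hcT
    have aux : ∀ S : Submodule ℂ (complexBetti X' (2 * q)), c ∈ S → S ≤ algebraicClasses X' q →
        c ∈ algebraicClasses X' q := fun S h₁ h₂ => h₂ h₁
    refine aux _ hmem ?_
    refine iSup_le fun d => iSup_le fun e => iSup_le fun hde => iSup_le fun he =>
      iSup_le fun W => iSup_le fun m' => iSup_le fun hm => iSup_le fun hW => iSup_le fun g => ?_
    subst hde
    exact (Submodule.map_mono (ih d (by omega) hW)).trans (hGys μ hμ hW hX' g hm)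
  -- every Hodge class on `X'` is algebraic: crux #2 splits it into algebraic + vertical
  have step : Submodule.span ℂ {c : complexBetti X' (2 * q) |
      IsRationalClass c ∧ IsOfHodgeType (2 * q) X' (2 * q) q q c} ≤ algebraicClasses X' q := by
    refine (hMid pr hX' hq (by omega) hsurj).trans (sup_le le_rfl (Submodule.span_le.2 ?_))
    rintro c ⟨hc, hh, T, hT, hTne, hcT⟩
    exact vert c hc hh T hT hTne hcT
  -- push down to `X` along `σ` (Gysin with `e = 0`)
  exact (hle q).trans ((Submodule.map_mono step).trans
    (hGys μ hμ hX' hX σ (show 2 * q + 0 = 2 * q by omega)))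

end Summit.HodgeConjecture.HodgeConjecture.Theorems

end
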